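import Summits.BirchSwinnertonDyer.BirchSwinnertonDyer.Theorems.UniversalToricDescentTwistedDualControl
import Literature.NumberTheory.EllipticCurves.ZpExtensionGaloisTwistLevelDualProofs
import HarnessLib

/-!
# Route UniversalToricDescent — Greenberg's twisted descent, the BASE LIFT (Prop. 4.13 for `A′ ⊗ χ_u` at level `K`, finite level):
# orthogonality of level-`j` targets to the dual Selmer group of the strict structure by EXPONENT BOOKKEEPING, hence the lift

Lead prover bsd-wall-utd-p1 g14 (`--supports` ♭T′ stmt-BirchSwinnertonDyer-26975; line `sigmacongruence` v3, brick F4 for the twin stubs TS1/TS2;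
memo HOME/bsd-wall-utd-p1/TWIST-ENGINE-utdp1g14.md §3). Greenberg, LNM 1716 pp. 122–125: «`S'_{T^*}(F)` … is finite … Hence `σ` is
trivial … `coker(γ')` is trivial». Single-level form (as in the tree's `CasselsOfPT` and t42's `TwistedDescentLevelDualProofs`): a dual
Selmer class `y` of the strict structure `𝓕_Q` at level `J = j + d`, `d ≥ a + 2b`, is killed by `p^{a+2b}` (`…TwistedDualControl`,
through the twisted Weil duality), is locally trivial at the conjugate prime `𝔭 ∉ Q` (`𝓕_𝔭 = ⊤`), so `H¹(ι^D) y = 0`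
(t42 `map_twistedTorsionInclDual_eq_zero_of_res_eq_zero`, granted that the twisted `Γ_{K_𝔭}`-invariants of `M_J^D` die under `p^f`,
`f ≤ j`), and the local term of a target `ι_* τ_q` of level `j` is `⟨ι_* τ_q, y_q⟩ = ⟨τ_q, (ι^D)_* y_q⟩ = 0`
(t42 `localTatePairingZMod_map_twistedTorsionIncl`).

* §1 `sum_localTatePairing_eq_zero_of_mem_dualSelmer_strict` — the orthogonality;
* §2 `exists_twistedLift_strict` — with `exists_twistedLift_strict_of_orthogonal`: for every family of level-`j` targets `τ_q` on `Q`
  there is `x ∈ H¹(Γ_K, E[p^J](χ_u))`, unramified outside `S₀ ∪ {v ∣ p}`, with `loc_q x = ι_* τ_q` at every `q ∈ Q` — GIVEN the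
  Poitou–Tate fact at level `p^J`, the `u`-eigenvector exponent `a` on `Sel_𝔭^{S₀}(K_∞, E[p^∞])` (generic `u`, `…TwistedEigenFinite`), `b`
  for `E[p^∞]^{Gal(K̄/K_∞)}`, `hsplit` (`…TwistedSplitPlaces`), and the local invariant bound `hinv` at `𝔭`.

HONEST STATUS: helper theorems (the base step of the rank-free road; the tower-level descent, `hinv` from the finiteness of
`E(K_{∞,𝔭})[p^∞]` through the Weil identification, and the Weil-pairing data remain inputs). THEOREMS ONLY; no definition, no named
fact, no `sorry`. BSD is not advanced by this file.
References: [GreenbergLNM1716] §4 Prop. 4.13 and pp. 122–125; [Howard2004HeegnerKolyvagin] Thm. 2.1.11; [MilneADT2006] I Cor. 2.3, Thm. 4.10.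
-/

set_option autoImplicit false
-- `…BirchSwinnertonDyer.BirchSwinnertonDyer.Theorems…` is the problem's mandated namespace (D-0017).
set_option linter.dupNamespace false

noncomputable section
open scoped Classical

namespace Summit.BirchSwinnertonDyer.BirchSwinnertonDyer.Theorems.UniversalToricDescentTwistedDescent

open NumberField IsDedekindDomain Field WeierstrassCurve CategoryTheory
  Literature.NumberTheory.EllipticCurves Literature.NumberTheory.GaloisRepresentations Literature.NumberTheory.GaloisCohomology
  Literature.NumberTheory.EllipticCurves.GreenbergSelmer Literature.NumberTheory.EllipticCurves.GreenbergVatsal2000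
  Summit.BirchSwinnertonDyer.Rank1Residual.X11b Summit.BirchSwinnertonDyer.Rank1Residual.X11b.AcSelmer
open Literature.NumberTheory.GaloisRepresentations.DiscreteGaloisModule (localTatePairingZMod unramifiedSubgroup TateDual
  SelmerStructure)

variable {K : Type} [Field K] [NumberField K] (W : WeierstrassCurve K) [W.IsElliptic] (p : ℕ) [Fact p.Prime]
  (κ : ZpExtension K p) (S₀ : Finset (HeightOneSpectrum (𝓞 K))) {j J : ℕ} (hjJ : j ≤ J) {u u' : ℤ}
  (hu : (p : ℤ) ∣ u - 1) (hu' : (p : ℤ) ∣ u' - 1) (huu' : ((p : ℤ) ^ J) ∣ u * u' - 1)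
  (e : W.geomTorsion ((p ^ J : ℕ) : ℤ) → W.geomTorsion ((p ^ J : ℕ) : ℤ) → AlgebraicClosure K)
  (hμ : ∀ S T, e S T ^ (p ^ J) = 1)
  (hadd₁ : ∀ S₁ S₂ T, e (S₁ + S₂) T = e S₁ T * e S₂ T)
  (hadd₂ : ∀ S T₁ T₂, e S (T₁ + T₂) = e S T₁ * e S T₂)
  (hgal : ∀ (σ : absoluteGaloisGroup K) (S T : W.geomTorsion ((p ^ J : ℕ) : ℤ)),
    σ • e S T = e (σ • S) (σ • T))
  (hnondeg : ∀ T, (∀ S, e S T = 1) → T = 0)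
  [Finite (W.geomTorsion ((p ^ j : ℕ) : ℤ))] [Finite (W.geomTorsion ((p ^ J : ℕ) : ℤ))] [CharZero K]

include hu' huu' hμ hadd₁ hadd₂ hgal hnondeg

/-! ### §1 Orthogonality of level-`j` targets on `Q` to the dual Selmer group of `𝓕_Q` -/

set_option maxHeartbeats 400000 in
/-- **Exponent bookkeeping ⟹ orthogonality.** `K` totally complex; `inv` with `IsPerfect` and `UnramifiedOrthogonal` at level `p^J`;
`M_J = E[p^J](χ_u)` unramified with `p^J ∉ v` off `S`; `Q ⊆ S` target places, `𝔭 ∣ p` with `𝔭 ∉ Q`; `hsplit`; `p^a` kills the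
`u`-eigenvectors of `conj_γ` on `Sel_𝔭^{S₀}(K_∞, E[p^∞])`, `p^b` kills `E[p^∞]^{Gal(K̄/K_∞)}`, `a + b + b ≤ J − j`; the twisted
`Γ_{K_𝔭}`-invariants of `M_J^D` die under `p^f`, `f ≤ j`. Then every target family supported on `Q` whose `Q`-components come from
level `j` (`t_q = H¹(ι) τ_q`) is orthogonal to `H¹_{𝓕_Q^*}(K, M_J^D)`. [cite: GreenbergLNM1716, §4 pp. 122–125]
[cite: MilneADT2006, Ch. I, Cor. 2.3] -/
theorem sum_localTatePairing_eq_zero_of_mem_dualSelmer_strict [IsTotallyComplex K]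
    {inv : LocalInvariants K (p ^ J)} (hperf : inv.IsPerfect) (hUO : inv.UnramifiedOrthogonal)
    (hS : ∀ v : HeightOneSpectrum (𝓞 K), (Sum.inr v : Place K) ∉ twistedDescentPlaces (K := K) p S₀ →
      ((p ^ J : ℕ) : 𝓞 K) ∉ v.asIdeal ∧ GaloisRep.IsUnramifiedAt v (W.twistedTorsionGaloisModule p κ J u hu))
    (Q : Finset (Place K)) (hQ : Q ⊆ twistedDescentPlaces (K := K) p S₀)
    {𝔭 : HeightOneSpectrum (𝓞 K)} (h𝔭 : ((p : ℕ) : 𝓞 K) ∈ 𝔭.asIdeal) (h𝔭Q : (Sum.inr 𝔭 : Place K) ∉ Q)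
    (hsplit : ∀ v : HeightOneSpectrum (𝓞 K), v ∉ S₀ → ((p : ℕ) : 𝓞 K) ∉ v.asIdeal → decomp v ≤ κ.kerSubgroup →
      unramifiedKer κ.kerSubgroup (W.geomPrimaryTorsion p) v ≤ awayKer κ.kerSubgroup (W.geomPrimaryTorsion p) v)
    {γ : absoluteGaloisGroup K} (hγ : κ.IsTopGenerator γ) {a b f : ℕ} (hab : a + b + b ≤ J - j) (hfj : f ≤ j)
    (ha : ∀ s ∈ selmerAc W p κ 𝔭 (S₀ : Set (HeightOneSpectrum (𝓞 K))), W.conjH1 p κ.kerSubgroup γ s = u • s → p ^ a • s = 0)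
    (hb : ∀ P : W.geomPrimaryTorsion p, (∀ h : κ.kerSubgroup, h • P = P) → p ^ b • P = 0)
    (hinv : ∀ m : TateDual K (W.geomTorsion ((p ^ J : ℕ) : ℤ)) (p ^ J),
      (∀ σ : absoluteGaloisGroup (𝔭.adicCompletion K),
        (W.twistedTorsionGaloisModule p κ J u hu).tateDual (p ^ J) (absGaloisRestrict K (𝔭.adicCompletion K) σ) m = m) →
      ((p ^ f : ℕ) : ℤ) • m = 0)
    (τ : Π v : Place K, galoisCohomology ((W.twistedTorsionGaloisModule p κ j u hu).toLocal v) 1)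
    (y : galoisCohomology ((W.twistedTorsionGaloisModule p κ J u hu).tateDual (p ^ J)) 1)
    (hy : y ∈ (inv.dualSelmerStructure (W.twistedTorsionGaloisModule p κ J u hu)
        (fun v ↦ if v ∈ Q then ⊥ else W.twistedRelaxedSelmerStructure p S₀ κ J u hu v)).selmerGroup) :
    ∑ v ∈ twistedDescentPlaces (K := K) p S₀,
      localTatePairingZMod (W.twistedTorsionGaloisModule p κ J u hu) (p ^ J) v (inv v)
        (if v ∈ Q then galoisCohomology.map ((W.twistedTorsionIncl p κ hjJ u hu).restrictField (Place.Completion v)) 1 (τ v)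
          else 0)
        (galoisCohomology.localization ((W.twistedTorsionGaloisModule p κ J u hu).tateDual (p ^ J)) v 1 y) = 0 := by
  -- `y = H¹(w) y'` and `p^{a+b+b} y' = 0` (dual-side control), hence `p^{J-j} y = 0`
  set y' := galoisCohomology.map (W.twistedWeilDualInv p κ J hu hu' huu' e hμ hadd₁ hadd₂ hgal hnondeg) 1 y with hy'def
  have hyy' : galoisCohomology.map (W.twistedWeilDual p κ J hu hu' huu' e hμ hadd₁ hadd₂ hgal) 1 y' = y :=
    W.map_twistedWeilDual_map_inv p κ J hu hu' huu' e hμ hadd₁ hadd₂ hgal hnondeg y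
  have hexp : p ^ (a + b + b) • y' = 0 :=
    pow_smul_eq_zero_of_mem_dualSelmer_strict W p κ J S₀ hu hu' huu' e hμ hadd₁ hadd₂ hgal hnondeg hperf hUO hS Q hQ h𝔭 h𝔭Q
      hsplit hγ ha hb y' (by rw [hyy']; exact hy)
  have hyJ : p ^ (J - j) • y = 0 := by
    obtain ⟨d, hd⟩ := Nat.exists_eq_add_of_le hab
    rw [← hyy', ← map_nsmul, hd, add_comm, pow_add, mul_smul, hexp, smul_zero, map_zero]
  -- `y` is locally trivial at `𝔭` (`𝓕_𝔭 = ⊤`), hence `H¹(ι^D) y = 0`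
  have h𝔭S : (Sum.inr 𝔭 : Place K) ∈ twistedDescentPlaces (K := K) p S₀ :=
    (inr_mem_twistedDescentPlaces_iff p S₀ 𝔭).2 (Or.inr h𝔭)
  have hloc : galoisCohomology.res ((W.twistedTorsionGaloisModule p κ J u hu).tateDual (p ^ J)) (𝔭.adicCompletion K) 1 y = 0 :=
    localization_eq_zero_of_mem_dualSelmer_strict W p S₀ κ J u hu hperf Q hy h𝔭S h𝔭Q
  have hdual : galoisCohomology.map (W.twistedTorsionInclDual p κ hjJ u hu) 1 y = 0 :=
    W.map_twistedTorsionInclDual_eq_zero_of_res_eq_zero p κ hjJ u hu W.zsmul_geomPoints_surjective_holds hfj hinv y hyJ hloc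
  -- term by term
  refine Finset.sum_eq_zero fun v _ ↦ ?_
  by_cases hvQ : v ∈ Q
  · rw [if_pos hvQ, W.localTatePairingZMod_map_twistedTorsionIncl p κ hjJ u hu v (inv v) (τ v)]
    have hnat : galoisCohomology.map ((W.twistedTorsionInclDual p κ hjJ u hu).restrictField (Place.Completion v)) 1
        (galoisCohomology.localization ((W.twistedTorsionGaloisModule p κ J u hu).tateDual (p ^ J)) v 1 y) = 0 := by
      have h := galoisCohomology.res_map_one (Place.Completion v) (W.twistedTorsionInclDual p κ hjJ u hu) y
      rw [hdual, map_zero] at h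
      exact h.symm
    rw [hnat]
    exact map_zero _
  · rw [if_neg hvQ, map_zero, AddMonoidHom.zero_apply]

/-! ### §2 The twisted base lift with exact level-`j` values on `Q` -/

set_option maxHeartbeats 400000 in
/-- **Greenberg's Prop. 4.13 for `A′ ⊗ χ_u` at level `K`, finite-level strict form (Castella's structure).** Under the hypotheses of
§1 and GIVEN the Poitou–Tate duality for Selmer structures over `K` (the tree's PROVED fact, instantiated at `n = p^J`): for every
family `τ` of level-`j` local classes there is `x ∈ H¹(Γ_K, E[p^J](χ_u))`, unramified at every finite `v ∉ S₀` prime to `p`, with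
`loc_q x = H¹(ι) τ_q` at every `q ∈ Q`. [cite: GreenbergLNM1716, §4 Prop. 4.13 and pp. 122–125] [cite: Howard2004HeegnerKolyvagin, Thm. 2.1.11] -/
theorem exists_twistedLift_strict [IsTotallyComplex K] (hPT : poitouTate_selmerStructure_duality K)
    (hS : ∀ v : HeightOneSpectrum (𝓞 K), (Sum.inr v : Place K) ∉ twistedDescentPlaces (K := K) p S₀ →
      ((p ^ J : ℕ) : 𝓞 K) ∉ v.asIdeal ∧ GaloisRep.IsUnramifiedAt v (W.twistedTorsionGaloisModule p κ J u hu))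
    (Q : Finset (Place K)) (hQ : Q ⊆ twistedDescentPlaces (K := K) p S₀)
    {𝔭 : HeightOneSpectrum (𝓞 K)} (h𝔭 : ((p : ℕ) : 𝓞 K) ∈ 𝔭.asIdeal) (h𝔭Q : (Sum.inr 𝔭 : Place K) ∉ Q)
    (hsplit : ∀ v : HeightOneSpectrum (𝓞 K), v ∉ S₀ → ((p : ℕ) : 𝓞 K) ∉ v.asIdeal → decomp v ≤ κ.kerSubgroup →
      unramifiedKer κ.kerSubgroup (W.geomPrimaryTorsion p) v ≤ awayKer κ.kerSubgroup (W.geomPrimaryTorsion p) v)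
    {γ : absoluteGaloisGroup K} (hγ : κ.IsTopGenerator γ) {a b f : ℕ} (hab : a + b + b ≤ J - j) (hfj : f ≤ j)
    (ha : ∀ s ∈ selmerAc W p κ 𝔭 (S₀ : Set (HeightOneSpectrum (𝓞 K))), W.conjH1 p κ.kerSubgroup γ s = u • s → p ^ a • s = 0)
    (hb : ∀ P : W.geomPrimaryTorsion p, (∀ h : κ.kerSubgroup, h • P = P) → p ^ b • P = 0)
    (hinv : ∀ m : TateDual K (W.geomTorsion ((p ^ J : ℕ) : ℤ)) (p ^ J),
      (∀ σ : absoluteGaloisGroup (𝔭.adicCompletion K),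
        (W.twistedTorsionGaloisModule p κ J u hu).tateDual (p ^ J) (absGaloisRestrict K (𝔭.adicCompletion K) σ) m = m) →
      ((p ^ f : ℕ) : ℤ) • m = 0)
    (τ : Π v : Place K, galoisCohomology ((W.twistedTorsionGaloisModule p κ j u hu).toLocal v) 1) :
    ∃ x : galoisCohomology (W.twistedTorsionGaloisModule p κ J u hu) 1,
      (∀ v : HeightOneSpectrum (𝓞 K), v ∉ S₀ → ((p : ℕ) : 𝓞 K) ∉ v.asIdeal →
        galoisCohomology.res (W.twistedTorsionGaloisModule p κ J u hu) (v.adicCompletion K) 1 x ∈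
          unramifiedSubgroup ((W.twistedTorsionGaloisModule p κ J u hu).restrictField (v.adicCompletion K)) 1) ∧
      ∀ q ∈ Q, galoisCohomology.localization (W.twistedTorsionGaloisModule p κ J u hu) q 1 x =
        galoisCohomology.map ((W.twistedTorsionIncl p κ hjJ u hu).restrictField (Place.Completion q)) 1 (τ q) := by
  haveI : NeZero (p ^ J) := neZero_prime_pow p J
  obtain ⟨inv, hperf, -, hUO, hSC⟩ := hPT (p ^ J)
  obtain ⟨x, hxur, hxQ⟩ := exists_twistedLift_strict_of_orthogonal W p S₀ κ J u hu hSC hS Q hQ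
    (fun v ↦ if v ∈ Q then
      galoisCohomology.map ((W.twistedTorsionIncl p κ hjJ u hu).restrictField (Place.Completion v)) 1 (τ v) else 0)
    (fun y hy ↦ sum_localTatePairing_eq_zero_of_mem_dualSelmer_strict W p κ S₀ hjJ hu hu' huu' e hμ hadd₁ hadd₂ hgal hnondeg hperf
      hUO hS Q hQ h𝔭 h𝔭Q hsplit hγ hab hfj ha hb hinv τ y hy)
  refine ⟨x, hxur, fun q hq ↦ ?_⟩
  rw [hxQ q hq, if_pos hq]

end Summit.BirchSwinnertonDyer.BirchSwinnertonDyer.Theorems.UniversalToricDescentTwistedDescent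

end
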